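import Mathlib
import Summits.Ventures.PercRepro2.Defs
import Summits.Ventures.PercRepro2.ThreeEventCertificate
import Summits.Ventures.PercRepro2.ThreeEventAntipodal

/-!
# `Φ ≥ 0` on every finite cube modulo ANTIPODAL certificates: the induction on the dimension
(blind cell PercRepro2, p4 g35)

`antiCount_nonneg_of_antipodal_certificates`: if on every nonempty finite cube (of a universe) every
admissible quadruple `(G, H, M, B)` has an edge `e` and a finite nonnegative combination of admissible
quadruples of the same cube whose symmetrised pair weights are pointwise below the symmetrised cross
pair weight `χ_e^sym` AT THE ANTIPODAL PAIRS `(antipodeAt e ω, ω)` (`e` open in `ω`) — the statement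
(∀-ANTI) — then the antipodal count `Φ(J) = Σ_ω c(ω̄, ω)` is nonnegative for every admissible quadruple
on every finite cube of the universe (the cell's (FIB″), a weight-free strengthening of the three-event
lemma). Proof: induction on the cardinality of the index type; on the empty cube `Φ = 0`; otherwise
`Φ(J) ≥ Σ λ_i Φ_e(J_i)` (ThreeEventAntipodal) and `Φ_e(J_i)` is the antipodal count of the section of
`J_i` at `e` open on the cube `{f // f ≠ e}` of one dimension less. No definition, no instance, no
notation.
-/

namespace Summit.Ventures.PercRepro2

namespace ThreeEvent

section Induction

universe u

variable {R : Type*} [CommRing R] [LinearOrder R] [IsStrictOrderedRing R]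

/-- The sections at `e` open of an admissible quadruple form an admissible quadruple of the sub-cube. -/
lemma admissible_secAt {E : Type*} [DecidableEq E] (e : E) {G H M B : Set (Config E)}
    (h : IsUpperSet G ∧ IsUpperSet H ∧ IsUpperSet M ∧ IsLowerSet B ∧ M ⊆ G ∧ G ∩ B ⊆ M) :
    IsUpperSet (secAt e G) ∧ IsUpperSet (secAt e H) ∧ IsUpperSet (secAt e M) ∧ IsLowerSet (secAt e B)
      ∧ secAt e M ⊆ secAt e G ∧ secAt e G ∩ secAt e B ⊆ secAt e M :=
  ⟨isUpperSet_secAt e h.1, isUpperSet_secAt e h.2.1, isUpperSet_secAt e h.2.2.1,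
    isLowerSet_secAt e h.2.2.2.1, secAt_mono e h.2.2.2.2.1,
    by rw [← secAt_inter]; exact secAt_mono e h.2.2.2.2.2⟩

omit [LinearOrder R] [IsStrictOrderedRing R] in
/-- On the empty cube the antipodal count vanishes: the single antipodal pair is `(ω, ω)` and
`c(ω, ω) = 0` (the indicator of an intersection is the product of the indicators). -/
lemma antiCount_of_isEmpty {E : Type*} [Fintype E] [DecidableEq E] [IsEmpty E]
    (G H M B : Set (Config E)) : (antiCount G H M B : R) = 0 := by
  unfold antiCount
  refine Finset.sum_eq_zero fun ω _ => ?_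
  have hω : antipode ω = ω := Subsingleton.elim _ _
  rw [hω]
  simp only [pairWt]
  by_cases hG : ω ∈ G <;> by_cases hH : ω ∈ H <;> by_cases hM : ω ∈ M <;> by_cases hB : ω ∈ B <;>
    simp [Set.indicator, hG, hH, hM, hB]

/-- The cardinality of the sub-cube index type without `e`. -/
lemma card_ne_eq {E : Type*} [Fintype E] [DecidableEq E] (e : E) :
    Fintype.card {f // f ≠ e} = Fintype.card E - 1 := by
  rw [Fintype.card_subtype_compl, Fintype.card_subtype_eq]

/-- **The antipodal count is nonnegative modulo antipodal certificates** (induction on the dimension).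
Hypothesis `hcert` (the statement (∀-ANTI)/(∃-ANTI) of the cell): on every nonempty finite cube (of the
universe `u`) every admissible quadruple has an edge `e` with a finite nonnegative combination of
admissible quadruples of the same cube whose symmetrised pair weights are pointwise below the
symmetrised cross pair weight `χ_e^sym` AT THE ANTIPODAL PAIRS `(antipodeAt e ω, ω)`, `e` open in `ω`.
Conclusion: `Φ(J) ≥ 0` for every admissible quadruple on every finite cube of the universe. -/
theorem antiCount_nonneg_of_antipodal_certificates_card
    (hcert : ∀ (F : Type u) [Fintype F] [DecidableEq F], Nonempty F →
      ∀ (G H M B : Set (Config F)),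
        (IsUpperSet G ∧ IsUpperSet H ∧ IsUpperSet M ∧ IsLowerSet B ∧ M ⊆ G ∧ G ∩ B ⊆ M) →
        ∃ e : F, ∃ (k : ℕ) (G₁ H₁ M₁ B₁ : Fin k → Set (Config F)) (l : Fin k → R),
          (∀ i, IsUpperSet (G₁ i) ∧ IsUpperSet (H₁ i) ∧ IsUpperSet (M₁ i) ∧ IsLowerSet (B₁ i)
            ∧ M₁ i ⊆ G₁ i ∧ G₁ i ∩ B₁ i ⊆ M₁ i) ∧ (∀ i, 0 ≤ l i) ∧
          ∀ ω : Config F, ω e = true →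
            (∑ i, l i * (pairWt (G₁ i) (H₁ i) (M₁ i) (B₁ i) ω (antipodeAt e ω)
                + pairWt (G₁ i) (H₁ i) (M₁ i) (B₁ i) (antipodeAt e ω) ω))
              ≤ (pairWt G H M B (Function.update ω e false) (antipodeAt e ω)
                  + pairWt G H M B ω (Function.update (antipodeAt e ω) e false))
                + (pairWt G H M B (Function.update (antipodeAt e ω) e false) ω
                  + pairWt G H M B (antipodeAt e ω) (Function.update ω e false))) :
    ∀ (n : ℕ) (F : Type u) [Fintype F] [DecidableEq F], Fintype.card F = n →
      ∀ (G H M B : Set (Config F)), (IsUpperSet G ∧ IsUpperSet H ∧ IsUpperSet M ∧ IsLowerSet B ∧ M ⊆ G ∧ G ∩ B ⊆ M) →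
        (0 : R) ≤ antiCount G H M B := by
  intro n
  induction n with
  | zero =>
    intro F _ _ hF G H M B _
    haveI : IsEmpty F := Fintype.card_eq_zero_iff.mp hF
    rw [antiCount_of_isEmpty]
  | succ n ih =>
    intro F _ _ hF G H M B hadm
    haveI : Nonempty F := Fintype.card_pos_iff.mp (by omega)
    obtain ⟨e, k, G₁, H₁, M₁, B₁, l, hadm₁, hl, hpt⟩ := hcert F inferInstance G H M B hadm
    refine le_trans ?_ (antiCount_ge_of_antipodal_certificate e G H M B G₁ H₁ M₁ B₁ l hpt)
    refine Finset.sum_nonneg fun i _ => mul_nonneg (hl i) ?_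
    rw [antiCountAt_eq_antiCount_secAt]
    exact ih {f // f ≠ e} (by rw [card_ne_eq, hF]; rfl) _ _ _ _ (admissible_secAt e (hadm₁ i))

/-- **(FIB″) modulo antipodal certificates**: `Φ(J) ≥ 0` for every admissible quadruple on every finite
cube, if every admissible quadruple of every nonempty finite cube has an edge with an antipodal
certificate. -/
theorem antiCount_nonneg_of_antipodal_certificates
    (hcert : ∀ (F : Type u) [Fintype F] [DecidableEq F], Nonempty F →
      ∀ (G H M B : Set (Config F)),
        (IsUpperSet G ∧ IsUpperSet H ∧ IsUpperSet M ∧ IsLowerSet B ∧ M ⊆ G ∧ G ∩ B ⊆ M) →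
        ∃ e : F, ∃ (k : ℕ) (G₁ H₁ M₁ B₁ : Fin k → Set (Config F)) (l : Fin k → R),
          (∀ i, IsUpperSet (G₁ i) ∧ IsUpperSet (H₁ i) ∧ IsUpperSet (M₁ i) ∧ IsLowerSet (B₁ i)
            ∧ M₁ i ⊆ G₁ i ∧ G₁ i ∩ B₁ i ⊆ M₁ i) ∧ (∀ i, 0 ≤ l i) ∧
          ∀ ω : Config F, ω e = true →
            (∑ i, l i * (pairWt (G₁ i) (H₁ i) (M₁ i) (B₁ i) ω (antipodeAt e ω)
                + pairWt (G₁ i) (H₁ i) (M₁ i) (B₁ i) (antipodeAt e ω) ω))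
              ≤ (pairWt G H M B (Function.update ω e false) (antipodeAt e ω)
                  + pairWt G H M B ω (Function.update (antipodeAt e ω) e false))
                + (pairWt G H M B (Function.update (antipodeAt e ω) e false) ω
                  + pairWt G H M B (antipodeAt e ω) (Function.update ω e false)))
    (F : Type u) [Fintype F] [DecidableEq F] (G H M B : Set (Config F))
    (hadm : IsUpperSet G ∧ IsUpperSet H ∧ IsUpperSet M ∧ IsLowerSet B ∧ M ⊆ G ∧ G ∩ B ⊆ M) :
    (0 : R) ≤ antiCount G H M B :=
  antiCount_nonneg_of_antipodal_certificates_card hcert (Fintype.card F) F rfl G H M B hadm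

end Induction

end ThreeEvent

end Summit.Ventures.PercRepro2
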